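import Mathlib
import HarnessLib
import Summits.Ventures.LatticeQCDFlow.Exactness.LocationCouplingMask
import Summits.Ventures.LatticeQCDFlow.Exactness.DegreeOneLayerEquiv

/-!
# Location couplings (the plaquette BEHIND the active link): measurable automorphisms for any group with invertible kernels; the `U(1)` degree-one instance exact

HONEST FRAMING: exact (Metropolis-corrected) sampling algorithms for lattice gauge theory;
figures of merit are autocorrelation/cost numbers at stated couplings and volumes; no
continuum-physics claim.

Venture `LatticeQCDFlow` (cell pub-lqcd), topic `Exactness`; FANOUT row 10 (`eng-equiv`, engine
`latflow.equiv` v0.3 `masks.py` LOCATION couplings, presets `loc-checker` / `alternate`: the active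
link `(x, μ)` is driven by the plaquette at `x − ν̂`, i.e. `sign = −1`).  NEW WORK of the cell over
`LocationCouplingMask` (`behindPlaquetteKernelLayer_eq_coupleFun`, `hasJacobian_behindPlaquetteKernelLayer`:
the behind-plaquette kernel layer with frozen behind staple is `Theory2.coupleFun`, exact with the
kernels' densities), row 31's `Theory2.coupleEquiv`, row 14's `CircleGroupJacobian`
(`hasJacobian_circleGroup_of_degreeOne`) and `DegreeOneLayerEquiv` (`exists_coupleEquiv_of_hasDerivAt_pos`).
The twin of `PlaquetteKernelLayerEquiv` / `U1DegreeOnePlaquetteCouplingLayer` for the other plaquette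
of the link.  Nothing is cited as a fact; no number; no definition.

* **`exists_measurableEquiv_behindPlaquetteKernelLayer`** — ANY measurable group: active kernels
  realised by `φ a y : G ≃ᵐ G` jointly measurable with their inverses, behind staple frozen (`h4`–`h6`) ⟹
  `∃ Ψ : GaugeConfig d L G ≃ᵐ GaugeConfig d L G` with `⇑Ψ =` the behind-plaquette kernel layer and
  `⇑Ψ.symm =` the layer of the inverse kernels;
* **`exists_measurableEquiv_behindPlaquetteKernelLayer_hasJacobian`** — compact `G`: with kernel
  certificates `HasJacobian (Haar) (φ a y) (ofReal ∘ j a y)` the automorphism is EXACT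
  (`HasJacobian (⊗Haar) Ψ (ofReal ∘ coupleJac p (j at the behind loops))`);
* **`exists_measurableEquiv_u1DegreeOneBehindPlaquetteCouplingLayer`** — `U(1) = Circle`: kernels
  given by `C¹` degree-one lifts `Φ e y` with positive continuous derivative (spline or NCP mixture),
  jointly measurable in (frozen links, angle): the location coupling layer is an exact measurable
  automorphism of `GaugeConfig d L Circle` with the booked density `Φ' e y` at the behind-plaquette angle.
-/

noncomputable section

namespace Summit.Ventures.LatticeQCDFlow.Exactness

open Real MeasureTheory Summit.Ventures.LatticeQCDFlow.Theory2
open Literature.MathematicalPhysics.QuantumFieldTheory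
open scoped ENNReal

variable {d L : ℕ}

section AnyGroup

variable {G : Type*} [Group G] [MeasurableSpace G] [MeasurableMul₂ G] [MeasurableInv G]
  (p : Edge d L → Prop) [DecidablePred p] (ν : Edge d L → Fin d)
  (h4 : ∀ e, p e → ¬p ((e.1 - Pi.single (ν e) 1).shift e.2, ν e))
  (h5 : ∀ e, p e → ¬p (e.1 - Pi.single (ν e) 1, e.2))
  (h6 : ∀ e, p e → ¬p (e.1 - Pi.single (ν e) 1, ν e))
  (hol : GaugeConfig d L G → Edge d L → G → G)
  (H : Edge d L → ({f : Edge d L // ¬p f} → G) → G → G)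
  (hHV : ∀ (V : GaugeConfig d L G) (e : Edge d L), p e → hol V e = H e (fun f => V f))
  (φ : {e : Edge d L // p e} → ({f : Edge d L // ¬p f} → G) → G ≃ᵐ G)
  (hHφ : ∀ (a : {e : Edge d L // p e}) y, H a.1 y = ⇑(φ a y))
  (hφm : ∀ a, Measurable fun q : G × ({f : Edge d L // ¬p f} → G) => φ a q.2 q.1)
  (hφsm : ∀ a, Measurable fun q : G × ({f : Edge d L // ¬p f} → G) => (φ a q.2).symm q.1)

include hHV hHφ hφm hφsm in
/-- **A behind-plaquette kernel layer with invertible kernels is a measurable automorphism of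
`GaugeConfig d L G`.**  Active link `e = (x, μ)`, behind plaquette in the plane `ν e` at `x − ν̂`
whose other three links are frozen (`h4`–`h6`); kernel field `hol V e = H e (V|frozen)` whose active
kernels are measurable equivalences `φ a y` jointly measurable in (loop, frozen links) with their
inverses.  The forward map of `Ψ`
is the layer `V e ↦ hol V e (Q) Q⁻¹ V e` (`Q = V e · T` the behind loop, `T` the frozen behind staple),
the inverse is `V e ↦ (φ e (V|frozen))⁻¹(V e · T) · T⁻¹`. -/
theorem exists_measurableEquiv_behindPlaquetteKernelLayer :
    ∃ Ψ : GaugeConfig d L G ≃ᵐ GaugeConfig d L G,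
      (⇑Ψ = fun (V : GaugeConfig d L G) (e : Edge d L) =>
        if p e then
          hol V e (V e * ((V ((e.1 - Pi.single (ν e) 1).shift e.2, ν e))⁻¹ * (V (e.1 - Pi.single (ν e) 1, e.2))⁻¹ *
              V (e.1 - Pi.single (ν e) 1, ν e))) *
            (V e * ((V ((e.1 - Pi.single (ν e) 1).shift e.2, ν e))⁻¹ * (V (e.1 - Pi.single (ν e) 1, e.2))⁻¹ *
              V (e.1 - Pi.single (ν e) 1, ν e)))⁻¹ * V e
        else V e) ∧
      (⇑Ψ.symm = Theory2.coupleFun p fun a y v =>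
        (φ a y).symm (v * ((y ⟨_, h4 a.1 a.2⟩)⁻¹ * (y ⟨_, h5 a.1 a.2⟩)⁻¹ * y ⟨_, h6 a.1 a.2⟩)) *
          ((y ⟨_, h4 a.1 a.2⟩)⁻¹ * (y ⟨_, h5 a.1 a.2⟩)⁻¹ * y ⟨_, h6 a.1 a.2⟩)⁻¹) := by
  have hev : ∀ f₀ : {f : Edge d L // ¬p f}, Measurable fun y : ({f : Edge d L // ¬p f} → G) => y f₀ :=
    fun f₀ => measurable_pi_apply f₀
  have hT : ∀ a : {e // p e}, Measurable fun y : ({f : Edge d L // ¬p f} → G) =>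
      (y ⟨_, h4 a.1 a.2⟩)⁻¹ * (y ⟨_, h5 a.1 a.2⟩)⁻¹ * y ⟨_, h6 a.1 a.2⟩ := fun a =>
    ((hev _).inv.mul (hev _).inv).mul (hev _)
  have hloop : ∀ a : {e // p e}, Measurable fun q : G × ({f : Edge d L // ¬p f} → G) =>
      q.1 * ((q.2 ⟨_, h4 a.1 a.2⟩)⁻¹ * (q.2 ⟨_, h5 a.1 a.2⟩)⁻¹ * q.2 ⟨_, h6 a.1 a.2⟩) := fun a =>
    measurable_fst.mul ((hT a).comp measurable_snd)
  set ψ : {e // p e} → ({f : Edge d L // ¬p f} → G) → G ≃ᵐ G := fun a y =>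
    { toFun := fun u => φ a y (u * ((y ⟨_, h4 a.1 a.2⟩)⁻¹ * (y ⟨_, h5 a.1 a.2⟩)⁻¹ * y ⟨_, h6 a.1 a.2⟩)) *
        ((y ⟨_, h4 a.1 a.2⟩)⁻¹ * (y ⟨_, h5 a.1 a.2⟩)⁻¹ * y ⟨_, h6 a.1 a.2⟩)⁻¹
      invFun := fun v => (φ a y).symm (v * ((y ⟨_, h4 a.1 a.2⟩)⁻¹ * (y ⟨_, h5 a.1 a.2⟩)⁻¹ * y ⟨_, h6 a.1 a.2⟩)) *
        ((y ⟨_, h4 a.1 a.2⟩)⁻¹ * (y ⟨_, h5 a.1 a.2⟩)⁻¹ * y ⟨_, h6 a.1 a.2⟩)⁻¹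
      left_inv := fun u => by
        simp only [inv_mul_cancel_right, MeasurableEquiv.symm_apply_apply, mul_inv_cancel_right]
      right_inv := fun v => by
        simp only [inv_mul_cancel_right, MeasurableEquiv.apply_symm_apply, mul_inv_cancel_right]
      measurable_toFun := ((φ a y).measurable.comp (measurable_id.mul_const _)).mul_const _
      measurable_invFun := ((φ a y).symm.measurable.comp (measurable_id.mul_const _)).mul_const _ }
    with hψdef
  have hψm : ∀ a, Measurable fun q : G × ({f : Edge d L // ¬p f} → G) => ψ a q.2 q.1 := fun a =>
    ((hφm a).comp ((hloop a).prodMk measurable_snd)).mul ((hT a).comp measurable_snd).inv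
  have hψsm : ∀ a, Measurable fun q : G × ({f : Edge d L // ¬p f} → G) => (ψ a q.2).symm q.1 :=
    fun a => ((hφsm a).comp ((hloop a).prodMk measurable_snd)).mul ((hT a).comp measurable_snd).inv
  have hbridge := behindPlaquetteKernelLayer_eq_coupleFun p ν hol H hHV h4 h5 h6
  have hψeq : (fun (a : {e // p e}) (y : {f : Edge d L // ¬p f} → G) (u : G) =>
      H a.1 y (u * ((y ⟨_, h4 a.1 a.2⟩)⁻¹ * (y ⟨_, h5 a.1 a.2⟩)⁻¹ * y ⟨_, h6 a.1 a.2⟩)) *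
        (u * ((y ⟨_, h4 a.1 a.2⟩)⁻¹ * (y ⟨_, h5 a.1 a.2⟩)⁻¹ * y ⟨_, h6 a.1 a.2⟩))⁻¹ * u) =
      fun a y u => ψ a y u := by
    funext a y u
    rw [mul_assoc (H a.1 y _), mul_inv_rev, inv_mul_cancel_right, hHφ]
    rfl
  refine ⟨coupleEquiv ψ hψm hψsm, ?_, ?_⟩
  · rw [coe_coupleEquiv, hbridge, hψeq]
  · rfl

end AnyGroup

section Compact

variable {G : Type*} [Group G] [TopologicalSpace G] [IsTopologicalGroup G] [CompactSpace G]
  [MeasurableSpace G] [BorelSpace G] [MeasurableMul₂ G] [MeasurableInv G] [NeZero L]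
  (p : Edge d L → Prop) [DecidablePred p] (ν : Edge d L → Fin d)
  (h4 : ∀ e, p e → ¬p ((e.1 - Pi.single (ν e) 1).shift e.2, ν e))
  (h5 : ∀ e, p e → ¬p (e.1 - Pi.single (ν e) 1, e.2))
  (h6 : ∀ e, p e → ¬p (e.1 - Pi.single (ν e) 1, ν e))
  (hol : GaugeConfig d L G → Edge d L → G → G)
  (H : Edge d L → ({f : Edge d L // ¬p f} → G) → G → G)
  (hHV : ∀ (V : GaugeConfig d L G) (e : Edge d L), p e → hol V e = H e (fun f => V f))
  (φ : {e : Edge d L // p e} → ({f : Edge d L // ¬p f} → G) → G ≃ᵐ G)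
  (hHφ : ∀ (a : {e : Edge d L // p e}) y, H a.1 y = ⇑(φ a y))
  (hφm : ∀ a, Measurable fun q : G × ({f : Edge d L // ¬p f} → G) => φ a q.2 q.1)
  (hφsm : ∀ a, Measurable fun q : G × ({f : Edge d L // ¬p f} → G) => (φ a q.2).symm q.1)
  (j : Edge d L → ({f : Edge d L // ¬p f} → G) → G → ℝ)
  (hjm : ∀ a : {e : Edge d L // p e}, Measurable fun q : G × ({f : Edge d L // ¬p f} → G) => j a.1 q.2 q.1)
  (hJ : ∀ (a : {e : Edge d L // p e}) y, HasJacobian (haarProbability G) (φ a y) fun g => ENNReal.ofReal (j a.1 y g))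
  (hj0 : ∀ (a : {e : Edge d L // p e}) y g, 0 ≤ j a.1 y g)

include hHV hHφ hφm hφsm hjm hJ hj0 in
/-- **… and with certified kernels it is an EXACT automorphism** of `GaugeConfig d L G` for
`⊗_links haarProbability G`: `HasJacobian (⊗ Haar) Ψ (ofReal ∘ coupleJac p (j at the behind loops))`. -/
theorem exists_measurableEquiv_behindPlaquetteKernelLayer_hasJacobian :
    ∃ Ψ : GaugeConfig d L G ≃ᵐ GaugeConfig d L G,
      (⇑Ψ = fun (V : GaugeConfig d L G) (e : Edge d L) =>
        if p e then
          hol V e (V e * ((V ((e.1 - Pi.single (ν e) 1).shift e.2, ν e))⁻¹ * (V (e.1 - Pi.single (ν e) 1, e.2))⁻¹ *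
              V (e.1 - Pi.single (ν e) 1, ν e))) *
            (V e * ((V ((e.1 - Pi.single (ν e) 1).shift e.2, ν e))⁻¹ * (V (e.1 - Pi.single (ν e) 1, e.2))⁻¹ *
              V (e.1 - Pi.single (ν e) 1, ν e)))⁻¹ * V e
        else V e) ∧
      HasJacobian (MeasureTheory.Measure.pi fun _ : Edge d L => haarProbability G) Ψ
        fun V => ENNReal.ofReal (Theory2.coupleJac p (fun a y u =>
          j a.1 y (u * ((y ⟨_, h4 a.1 a.2⟩)⁻¹ * (y ⟨_, h5 a.1 a.2⟩)⁻¹ * y ⟨_, h6 a.1 a.2⟩))) V) := by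
  obtain ⟨Ψ, hΨ, -⟩ := exists_measurableEquiv_behindPlaquetteKernelLayer p ν h4 h5 h6 hol H hHV φ hHφ hφm hφsm
  refine ⟨Ψ, hΨ, ?_⟩
  have hev : ∀ f₀ : {f : Edge d L // ¬p f}, Measurable fun y : ({f : Edge d L // ¬p f} → G) => y f₀ :=
    fun f₀ => measurable_pi_apply f₀
  have hT : ∀ a : {e // p e}, Measurable fun y : ({f : Edge d L // ¬p f} → G) =>
      (y ⟨_, h4 a.1 a.2⟩)⁻¹ * (y ⟨_, h5 a.1 a.2⟩)⁻¹ * y ⟨_, h6 a.1 a.2⟩ := fun a =>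
    ((hev _).inv.mul (hev _).inv).mul (hev _)
  have hloop : ∀ a : {e // p e}, Measurable fun q : G × ({f : Edge d L // ¬p f} → G) =>
      q.1 * ((q.2 ⟨_, h4 a.1 a.2⟩)⁻¹ * (q.2 ⟨_, h5 a.1 a.2⟩)⁻¹ * q.2 ⟨_, h6 a.1 a.2⟩) := fun a =>
    measurable_fst.mul ((hT a).comp measurable_snd)
  have hHm : ∀ a : {e // p e}, Measurable fun q : G × ({f : Edge d L // ¬p f} → G) => H a.1 q.2 q.1 := by
    intro a
    simp_rw [hHφ]
    exact hφm a
  rw [hΨ]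
  refine hasJacobian_behindPlaquetteKernelLayer p ν hol H j hHV h4 h5 h6 (fun a => ?_)
    (fun a => ?_) (fun a y => ?_) hj0
  · exact (((hHm a).comp ((hloop a).prodMk measurable_snd)).mul (hloop a).inv).mul measurable_fst
  · exact (hjm a).comp ((hloop a).prodMk measurable_snd)
  · rw [hHφ]; exact hJ a y

end Compact

/-! ## `U(1)`: degree-one kernels (splines, NCP mixtures) behind the link -/

section Circle

variable [NeZero L]
  (p : Edge d L → Prop) [DecidablePred p] (ν : Edge d L → Fin d)
  (h4 : ∀ e, p e → ¬p ((e.1 - Pi.single (ν e) 1).shift e.2, ν e))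
  (h5 : ∀ e, p e → ¬p (e.1 - Pi.single (ν e) 1, e.2))
  (h6 : ∀ e, p e → ¬p (e.1 - Pi.single (ν e) 1, ν e))
  {Φ Φ' : Edge d L → ({f : Edge d L // ¬p f} → Circle) → ℝ → ℝ}
  (hderiv : ∀ e y θ, HasDerivAt (Φ e y) (Φ' e y θ) θ) (hcont : ∀ e y, Continuous (Φ' e y))
  (hpos : ∀ e y θ, 0 < Φ' e y θ) (hdeg : ∀ e y θ, Φ e y (θ + 2 * π) = Φ e y θ + 2 * π)
  (hΦm : ∀ e, Measurable fun w : ℝ × ({f : Edge d L // ¬p f} → Circle) => Φ e w.2 w.1)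
  (hΦ'm : ∀ e, Measurable fun w : ℝ × ({f : Edge d L // ¬p f} → Circle) => Φ' e w.2 w.1)
  (hol : GaugeConfig d L Circle → Edge d L → Circle → Circle)
  (H : Edge d L → ({f : Edge d L // ¬p f} → Circle) → Circle → Circle)
  (hHV : ∀ (V : GaugeConfig d L Circle) (e : Edge d L), p e → hol V e = H e (fun f => V f))
  (hH : ∀ e y (θ : ℝ), H e y (Circle.exp θ) = Circle.exp (Φ e y θ))
  (j : Edge d L → ({f : Edge d L // ¬p f} → Circle) → Circle → ℝ)
  (hj : ∀ e y (θ : ℝ), j e y (Circle.exp θ) = Φ' e y θ)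

include hderiv hcont hpos hdeg hΦm hΦ'm hHV hH hj in
/-- **The `U(1)` location coupling layer with `C¹` degree-one kernels is an exact measurable
automorphism of `GaugeConfig d L Circle`.**  Kernels `H e y (e^{iθ}) = e^{iΦ e y θ}` (lifts `C¹`,
positive continuous derivative, degree one, jointly measurable in (frozen links, angle)), booked
density `j e y (e^{iθ}) = Φ' e y θ` at the behind-plaquette angle; the behind staple frozen.  Then
`∃ Ψ ≃ᵐ` with `⇑Ψ =` the layer and `HasJacobian (⊗ haarProbability Circle) Ψ (ofReal ∘ coupleJac p j)`. -/
theorem exists_measurableEquiv_u1DegreeOneBehindPlaquetteCouplingLayer :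
    ∃ Ψ : GaugeConfig d L Circle ≃ᵐ GaugeConfig d L Circle,
      (⇑Ψ = fun (V : GaugeConfig d L Circle) (e : Edge d L) =>
        if p e then
          hol V e (V e * ((V ((e.1 - Pi.single (ν e) 1).shift e.2, ν e))⁻¹ * (V (e.1 - Pi.single (ν e) 1, e.2))⁻¹ *
              V (e.1 - Pi.single (ν e) 1, ν e))) *
            (V e * ((V ((e.1 - Pi.single (ν e) 1).shift e.2, ν e))⁻¹ * (V (e.1 - Pi.single (ν e) 1, e.2))⁻¹ *
              V (e.1 - Pi.single (ν e) 1, ν e)))⁻¹ * V e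
        else V e) ∧
      HasJacobian (MeasureTheory.Measure.pi fun _ : Edge d L => haarProbability Circle) Ψ
        fun V => ENNReal.ofReal (Theory2.coupleJac p (fun a y u =>
          j a.1 y (u * ((y ⟨_, h4 a.1 a.2⟩)⁻¹ * (y ⟨_, h5 a.1 a.2⟩)⁻¹ * y ⟨_, h6 a.1 a.2⟩))) V) := by
  obtain ⟨φe, hφe, hφem, hφesm⟩ := exists_coupleEquiv_of_hasDerivAt_pos (p := p)
    (Φ := fun a y => Φ a.1 y) (Φ' := fun a y => Φ' a.1 y)
    (fun a y θ => hderiv a.1 y θ) (fun a y θ => hpos a.1 y θ) (fun a y θ => hdeg a.1 y θ) (fun a => hΦm a.1)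
  have hHφ : ∀ (a : {e // p e}) y, H a.1 y = ⇑(φe a y) := by
    intro a y
    funext u
    obtain ⟨θ, rfl⟩ := Circle.exp_surjective u
    rw [hH, hφe]
  have hjm : ∀ a : {e // p e}, Measurable fun q : Circle × ({f : Edge d L // ¬p f} → Circle) => j a.1 q.2 q.1 := by
    intro a
    refine Circle.measurable_of_measurable_comp_exp_prod ?_
    simp_rw [hj]
    exact hΦ'm a.1
  refine exists_measurableEquiv_behindPlaquetteKernelLayer_hasJacobian p ν h4 h5 h6 hol H hHV φe hHφ hφem hφesm j hjm
    (fun a y => ?_) (fun a y g => ?_)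
  · rw [← hHφ]
    exact hasJacobian_circleGroup_of_degreeOne (hderiv a.1 y) (hcont a.1 y) (hpos a.1 y) (hdeg a.1 y)
      (hH a.1 y) (fun θ => by simp only [hj])
  · obtain ⟨θ, rfl⟩ := Circle.exp_surjective g
    rw [hj]
    exact (hpos a.1 y θ).le

end Circle

end Summit.Ventures.LatticeQCDFlow.Exactness
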